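import Literature.Computability.QuantumComplexity.ZeroNoiseExtrapolation
import HarnessLib

/-!
# Zero-noise (Richardson) extrapolation — instances at three gain factors (sequel)

Topic `Literature/InformationTheory/QuantumLearning` (pub-qadeq lane).  SEQUEL of
`Literature/Computability/QuantumComplexity/ZeroNoiseExtrapolation.lean` (namespace
`Literature.Computability.QuantumComplexity.ZNE`: `richardsonCoeff`, `sum_richardsonCoeff`,
`sum_richardsonCoeff_mul_pow`, `estimate_eq_of_expansion`, `gammaConst`, `abs_estimate_sub_le_gammaConst`,
`richardsonCoeff_fin_two`, the printed-sign note `prod_printed_eq_neg_one_pow_mul`, `expEstimate`), which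
formalises Temme–Bravyi–Gambetta's Richardson extrapolation in full.  DEDUP NOTE (gen 28): the first
version of THIS file (p331773) re-derived that material under a second namespace because a
case-sensitive `lean search 'Richardson|zeroNoise|extrapolat'` missed the existing declarations
(`richardsonCoeff`, `estimate`, …); this resubmission removes every duplicated declaration and keeps
only what the tree did not have — the closed form for THREE nodes and its value at the three gain
factors `G = 1, 1.2, 1.6` used by CLAIMS E-17 (Kim et al., Nature 618, 500 (2023), Methods: "All
experiments were carried out for `G = 1, 1.2, 1.6` and extrapolated as in Supplementary Information
II.B"), stated with the EXISTING vocabulary.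

HONEST FRAMING: instance-level adjudication of specific advantage claims; no claim about BQP vs BPP
or the summit.  Arithmetic on the printed gain values only; Kim et al. fit exponential and linear
models (their SI §II.B), which a three-point polynomial weight does not reproduce.

Sources: [TemmeBravyiGambetta2017] K. Temme, S. Bravyi, J. M. Gambetta, PRL 119, 180509 (2017) =
arXiv:1612.02058, main text ¶"Extrapolation to the zero noise limit" ("the coefficients
`γ_j = Π_{m≠j} c_m (c_j − c_m)⁻¹`" — solution of `Σ_j γ_j = 1`, `Σ_j γ_j c_j^k = 0`; "`Γ_n = Σ_j |γ_j|
c_j^{n+1}`") and Supplementary §III ("|E* − Ê^n_K(λ)| ≤ Σ_j |γ_j| (|R(c_j λ)| + |δ_j|)");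
[KimEtAl2023] Methods (the gains) and p. 3 ("the reduced bias from exponential extrapolation in
comparison with linear extrapolation").

Contents (all proved, 0 named facts): `richardsonCoeff_fin_three` (three nodes:
`γ₀ = c₁c₂/((c₁−c₀)(c₂−c₀))` etc.), `richardsonCoeff_kim_gains` (`γ = (16, −20, 5)` at `1, 6/5, 8/5`),
`sum_abs_richardsonCoeff_kim_gains` (`Σ_j |γ_j| = 41` — the factor multiplying a common statistical
error `δ*` in the Supplement's triangle bound), `gammaConst_kim_gains` (`Γ₂ = 1776/25 = 71.04`).
-/

noncomputable section

open Finset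

namespace Literature.InformationTheory.QuantumLearning.ZeroNoiseExtrapolation

open Literature.Computability.QuantumComplexity.ZNE

/-- Three nodes: `γ₀ = c₁/(c₁ − c₀) · c₂/(c₂ − c₀)`, `γ₁ = c₀/(c₀ − c₁) · c₂/(c₂ − c₁)`,
`γ₂ = c₀/(c₀ − c₂) · c₁/(c₁ − c₂)`. [cite: TemmeBravyiGambetta2017, main text ¶"Extrapolation to the zero noise limit" (closed form of γ_j, n = 2)] -/
theorem richardsonCoeff_fin_three (c₀ c₁ c₂ : ℝ) :
    richardsonCoeff ![c₀, c₁, c₂] 0 = c₁ / (c₁ - c₀) * (c₂ / (c₂ - c₀)) ∧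
    richardsonCoeff ![c₀, c₁, c₂] 1 = c₀ / (c₀ - c₁) * (c₂ / (c₂ - c₁)) ∧
    richardsonCoeff ![c₀, c₁, c₂] 2 = c₀ / (c₀ - c₂) * (c₁ / (c₁ - c₂)) := by
  unfold richardsonCoeff
  have h0 : (univ : Finset (Fin 3)).erase 0 = {1, 2} := by decide
  have h1 : (univ : Finset (Fin 3)).erase 1 = {0, 2} := by decide
  have h2 : (univ : Finset (Fin 3)).erase 2 = {0, 1} := by decide
  rw [h0, h1, h2, Finset.prod_pair (by decide), Finset.prod_pair (by decide),
    Finset.prod_pair (by decide)]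
  simp

/-- At the gains `G = 1, 1.2, 1.6` of Kim et al. the three-point Richardson weights are
`(16, −20, 5)`. [cite: KimEtAl2023, Methods ("All experiments were carried out for G = 1, 1.2, 1.6 and extrapolated as in Supplementary Information II.B")]
[cite: TemmeBravyiGambetta2017, main text ¶"Extrapolation to the zero noise limit" (closed form of γ_j)] -/
theorem richardsonCoeff_kim_gains :
    richardsonCoeff ![(1 : ℝ), 6 / 5, 8 / 5] 0 = 16 ∧
    richardsonCoeff ![(1 : ℝ), 6 / 5, 8 / 5] 1 = -20 ∧
    richardsonCoeff ![(1 : ℝ), 6 / 5, 8 / 5] 2 = 5 := by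
  obtain ⟨h0, h1, h2⟩ := richardsonCoeff_fin_three (1 : ℝ) (6 / 5) (8 / 5)
  refine ⟨?_, ?_, ?_⟩
  · rw [h0]; norm_num
  · rw [h1]; norm_num
  · rw [h2]; norm_num

/-- … hence `Σ_j |γ_j| = 41` there: the factor by which the Supplement's triangle bound
`Σ_j |γ_j| (|R_j| + |δ_j|)` multiplies a common statistical error `δ*` for a quadratic fit at those
gains. [cite: TemmeBravyiGambetta2017, Supplementary §III ("|E* − Ê^n_K(λ)| ≤ Σ_j |γ_j| (|R(c_j λ)| + |δ_j|)")]
[cite: KimEtAl2023, Methods (gains G = 1, 1.2, 1.6)] -/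
theorem sum_abs_richardsonCoeff_kim_gains :
    ∑ j, |richardsonCoeff ![(1 : ℝ), 6 / 5, 8 / 5] j| = 41 := by
  obtain ⟨h0, h1, h2⟩ := richardsonCoeff_kim_gains
  rw [Fin.sum_univ_three, h0, h1, h2]; norm_num

/-- … and the printed error-amplification constant there is `Γ₂ = Σ_j |γ_j| c_j³ = 1776/25`
(`= 71.04`). [cite: TemmeBravyiGambetta2017, main text ("Γ_n = Σ_j |γ_j| c_j^{n+1}")]
[cite: KimEtAl2023, Methods (gains G = 1, 1.2, 1.6)] -/
theorem gammaConst_kim_gains : gammaConst ![(1 : ℝ), 6 / 5, 8 / 5] = 1776 / 25 := by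
  obtain ⟨h0, h1, h2⟩ := richardsonCoeff_kim_gains
  unfold gammaConst
  rw [Fin.sum_univ_three, h0, h1, h2]
  simp only [Matrix.cons_val_zero, Matrix.cons_val_one, Matrix.cons_val]
  norm_num

end Literature.InformationTheory.QuantumLearning.ZeroNoiseExtrapolation
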